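import Summits.QuantumFields.YangMills.Theorems.SlowBitWindowInsertionTraceDefs
import Summits.QuantumFields.YangMills.Theorems.LuscherReductionRunningReductionTraceFormulaKernel
import Literature.Analysis.OperatorTheory.HeterogeneousCyclicPeeling
import Literature.Analysis.OperatorTheory.CyclicKernelSpectralBound
import HarnessLib

/-!
# Two-insertion zero-flux thermal traces: peeling the cycle to the two-arc form

Support module for the doors `SlowBitWindow.TraceDoor` (stmt-QuantumFields-23273) and `SlowBitWindow.JensenDoor`
(stmt-QuantumFields-23274) of route `SlowBitWindow` (D-0145 LINE g10-A of seat ym-idea-4; target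
`ThermalTraceWindow.SubFemtoFirstLevel`).  For the two-insertion trace `TT.insTrace L β O m` (p661692:
the closed chain of `2L` transfer kernels, the seam carrying the physical average, with a physical observable `O` inserted at
time slices `0` and `m`) we prove the path-space side of `Tr_phys(M_O (PK_β)^m M_O (PK_β)^{2L-m})`:

* §1 `insTrace_integrand_eq` — the integrand is a heterogeneous cyclic product of bond kernels: `K_β` on every bond, except the
  bond into slice `m`, which carries `K_β(x,y) O(y)`, and the closing bond, which carries `K_β^P(x,y) O(y)`;
* §2 `insTrace_eq_twoArc_K` — Literature `integral_cyclic_het_eq_foldr` (peeling the cycle at slice `0`) and the reduction of the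
  nested operators give the TWO-ARC FORM `insTrace L β O m = ∫ O(x) (κ^[m] (O · κ^[2L-1-m] K_β^P(·,x)))(x) dx`, `κ` the pointwise
  operator of `K_β`;
* §3 `insTrace_eq_twoArc` — on physical seeds the `K_β`- and `K_β^P`-iterates coincide (`iterate_physKernelOp_eq`), so every `κ` may be
  replaced by the pointwise operator `κ_P` of the physically averaged kernel `K_β^P` (symmetric, bounded, jointly measurable);
* §4 `integral_iterKernelP_mul`, `insTrace_eq_insertOne` — the composed kernels `K_β^{P,(j+1)}(x,y) = (κ_P^[j] K_β^P(·,y))(x)` act as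
  `κ_P^[j+1]` (Fubini), whence the ONE-BOND-INSERTION FORM
  `insTrace L β O m = ∫∫ X_m(x,y) (κ_P^[2L-1-m] K_β^P(·,x))(y) dy dx` with the composite bond `X_m(x,y) = O(x) K_β^{P,(m)}(x,y) O(y)` —
  exactly the left-hand side of Literature `hasSum_integral_iterate_insert_one` (spectral side: the companion module
  `SlowBitWindowInsertionTraceSpectral`).

HONEST FRAMING: fixed-lattice transfer-matrix bookkeeping (Fubini and re-indexing) for an M-sized support item of a DRAFT line onto a
RECORD rung (K2a); no renormalisation-group content; nothing here bears on infinite volume, the continuum limit, a mass gap or Clay.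
References: [cite: MontvayMunster1994, (3.145)]; [cite: Luscher1983, §2]; [cite: ReedSimonI1980, Thm. VI.23].
-/

set_option autoImplicit false

noncomputable section

open MeasureTheory Filter Topology Real Function
open Literature.MathematicalPhysics.QuantumFieldTheory
open Literature.MathematicalPhysics.QuantumLattice
open Literature.Analysis.OperatorTheory.YMMatrixModel
open Literature.Analysis.OperatorTheory
open scoped InnerProductSpace BigOperators

namespace Summit.QuantumFields.YangMills.Theorems.FemtoTransferGap.TT

open Summit.QuantumFields.YangMills.Theorems.FemtoTransferGap
open Summit.QuantumFields.YangMills.Theorems.FemtoTransferGap.PhysL2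

variable {L : ℕ} [NeZero L]

/-! ## §1 The integrand of `insTrace` as a heterogeneous cyclic product -/

/-- The integrand of `insTrace L β O m` (on `n + 1` slices, `1 ≤ m ≤ n`) is the cyclic product of the bond kernels
`κ_t = K_β` (`t ≠ m-1, n`), `κ_{m-1}(x,y) = K_β(x,y) O(y)`, `κ_n(x,y) = K_β^P(x,y) O(y)`. [folklore] -/
theorem insTrace_integrand_eq (β : ℝ) (O : GaugeConfig 3 L SU2 → ℝ) {n m : ℕ} (hm : 1 ≤ m) (hmn : m ≤ n)
    (V : Fin (n + 1) → GaugeConfig 3 L SU2) :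
    (∏ i : Fin n, transferKernel su2Rep β (V i.castSucc) (V i.succ)) *
        physAvg (transferKernel su2Rep β (V (Fin.last n))) (V 0) *
        (O (V 0) * O (V ⟨m % (n + 1), Nat.mod_lt _ (Nat.succ_pos _)⟩)) =
      ∏ t : Fin (n + 1), (fun s : ℕ => if s = n then (fun x y => physKernel (L := L) β x y * O y)
        else if s + 1 = m then (fun x y => transferKernel su2Rep β x y * O y) else transferKernel su2Rep β) t (V t) (V (t + 1)) := by
  have hmod : m % (n + 1) = m := Nat.mod_eq_of_lt (by omega)
  have hVm : V ⟨m % (n + 1), Nat.mod_lt _ (Nat.succ_pos _)⟩ = V ⟨m, by omega⟩ := by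
    congr 1; exact Fin.ext hmod
  rw [hVm]
  symm
  rw [Fin.prod_univ_castSucc]
  -- the closing bond
  have hlast : (fun s : ℕ => if s = n then (fun x y => physKernel (L := L) β x y * O y)
        else if s + 1 = m then (fun x y => transferKernel su2Rep β x y * O y) else transferKernel su2Rep β)
        ((Fin.last n : Fin (n + 1)) : ℕ) (V (Fin.last n)) (V (Fin.last n + 1)) =
      physKernel β (V (Fin.last n)) (V 0) * O (V 0) := by
    simp only [Fin.val_last, if_true, Fin.last_add_one]
  rw [hlast]
  -- the open path: every bond is `K_β`, the bond into slice `m` carries the extra factor `O(V m)`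
  set i₀ : Fin n := ⟨m - 1, by omega⟩ with hi₀
  have hcast : ∀ i : Fin n, (fun s : ℕ => if s = n then (fun x y => physKernel (L := L) β x y * O y)
        else if s + 1 = m then (fun x y => transferKernel su2Rep β x y * O y) else transferKernel su2Rep β)
        ((Fin.castSucc i : Fin (n + 1)) : ℕ) (V (Fin.castSucc i)) (V (Fin.castSucc i + 1)) =
      transferKernel su2Rep β (V i.castSucc) (V i.succ) * (if i = i₀ then O (V i.succ) else 1) := by
    intro i
    have hi : (i : ℕ) ≠ n := ne_of_lt i.isLt
    simp only [Fin.val_castSucc, Fin.coeSucc_eq_succ]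
    rw [if_neg hi]
    by_cases h : (i : ℕ) + 1 = m
    · have hi' : i = i₀ := Fin.ext (by rw [hi₀]; dsimp only; omega)
      rw [if_pos h, if_pos hi']
    · have hi' : i ≠ i₀ := fun h' => h (by rw [h', hi₀]; dsimp only; omega)
      rw [if_neg h, if_neg hi', mul_one]
  simp only [hcast]
  rw [Finset.prod_mul_distrib, Finset.prod_ite_eq' Finset.univ i₀, if_pos (Finset.mem_univ _)]
  have hsucc : i₀.succ = (⟨m, by omega⟩ : Fin (n + 1)) := Fin.ext (by simp [hi₀]; omega)
  rw [hsucc, physKernel]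
  ring

/-! ## §2 Peeling: the two-arc form with `K_β`-iterates -/

/-- Scalars pull out of kernel iterates: `κ^[j] (g · c) = (κ^[j] g) · c`. [folklore] -/
theorem iterate_kernelOp_mul_const (K : GaugeConfig 3 L SU2 → GaugeConfig 3 L SU2 → ℝ) (j : ℕ)
    (g : GaugeConfig 3 L SU2 → ℝ) (c : ℝ) :
    (fun f : GaugeConfig 3 L SU2 → ℝ => fun w => ∫ z, K w z * f z ∂configMeasure SU2 L)^[j] (fun w => g w * c) =
      fun w => ((fun f : GaugeConfig 3 L SU2 → ℝ => fun w => ∫ z, K w z * f z ∂configMeasure SU2 L)^[j] g) w * c := by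
  induction j with
  | zero => rfl
  | succ j ih =>
    rw [Function.iterate_succ_apply', Function.iterate_succ_apply', ih]
    funext w
    rw [← integral_mul_const]
    exact integral_congr_ae (ae_of_all _ fun z => by ring)

/-- **Two-arc form of the two-insertion trace, `K_β`-iterates.**  For `1 ≤ m ≤ 2L - 1` and a bounded measurable `O`,
`insTrace L β O m = ∫ O(x) · (κ^[m] (y ↦ O(y) · (κ^[2L-1-m] K_β^P(·, x))(y)))(x) dx`, `κ f = ∫ K_β(·,z) f(z) dz`: the cycle is cut at
slice `0` (Literature `integral_cyclic_het_eq_foldr`), the arc `0 → m` of `m` bonds and the arc `m → 0` of `2L - m` bonds (the last of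
them the physically averaged bond) become kernel iterates. [cite: MontvayMunster1994, (3.145)] -/
theorem insTrace_eq_twoArc_K (β : ℝ) {O : GaugeConfig 3 L SU2 → ℝ} (hOm : Measurable O) {CO : ℝ} (hOb : ∀ U, |O U| ≤ CO)
    {m : ℕ} (hm : 1 ≤ m) (hmL : m ≤ 2 * L - 1) :
    insTrace L β O m = ∫ x, O x * ((fun f : GaugeConfig 3 L SU2 → ℝ => fun w => ∫ z, transferKernel su2Rep β w z * f z ∂configMeasure SU2 L)^[m]
      (fun y => O y * ((fun f : GaugeConfig 3 L SU2 → ℝ => fun w => ∫ z, transferKernel su2Rep β w z * f z ∂configMeasure SU2 L)^[2 * L - 1 - m]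
        (fun w => physKernel β w x)) y)) x ∂configMeasure SU2 L := by
  obtain ⟨M, hM0, hM⟩ := exists_abs_transferKernel_le (L := L) β
  have hCO : 0 ≤ CO := (abs_nonneg _).trans (hOb (fun _ => 1))
  set n : ℕ := 2 * L - 1 with hn
  set K := transferKernel (L := L) su2Rep β with hKdef
  set κ : ℕ → GaugeConfig 3 L SU2 → GaugeConfig 3 L SU2 → ℝ := fun s => if s = n then (fun x y => physKernel (L := L) β x y * O y)
        else if s + 1 = m then (fun x y => K x y * O y) else K with hκdef
  -- measurability and a uniform bound of the bond kernels
  have hKm : Measurable (uncurry K) := (stronglyMeasurable_transferKernel (L := L) β).measurable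
  have hKPm : Measurable (uncurry (physKernel (L := L) β)) := (stronglyMeasurable_physKernel (L := L) β).measurable
  have hOm2 : Measurable fun p : GaugeConfig 3 L SU2 × GaugeConfig 3 L SU2 => O p.2 := hOm.comp measurable_snd
  have hκ : ∀ t, Measurable (uncurry (κ t)) := fun t => by
    by_cases ht : t = n
    · simp only [hκdef, ht, if_true]; exact hKPm.mul hOm2
    · by_cases ht' : t + 1 = m
      · simp only [hκdef, ht, if_false, ht', if_true]; exact hKm.mul hOm2
      · simp only [hκdef, ht, if_false, ht']; exact hKm
  have hC : ∀ t x y, ‖κ t x y‖ ≤ M * max CO 1 := fun t x y => by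
    have h1 : ‖K x y‖ ≤ M := by rw [Real.norm_eq_abs]; exact hM x y
    have h2 : ‖physKernel β x y‖ ≤ M := by rw [Real.norm_eq_abs]; exact abs_physKernel_le hM x y
    have h3 : ‖O y‖ ≤ max CO 1 := by rw [Real.norm_eq_abs]; exact (hOb y).trans (le_max_left _ _)
    have h4 : M ≤ M * max CO 1 := le_mul_of_one_le_right hM0 (le_max_right _ _)
    by_cases ht : t = n
    · simp only [hκdef, ht, if_true]; rw [norm_mul]; exact mul_le_mul h2 h3 (norm_nonneg _) hM0
    · by_cases ht' : t + 1 = m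
      · simp only [hκdef, ht, if_false, ht', if_true]; rw [norm_mul]; exact mul_le_mul h1 h3 (norm_nonneg _) hM0
      · simp only [hκdef, ht, if_false, ht']; exact h1.trans h4
  -- Step 1: the cyclic integral, relabelled to `Fin (1 + (n-1) + 1)`, then peeled
  have hn1 : n + 1 = 1 + (n - 1) + 1 := by
    have : 1 ≤ n := by rw [hn]; have := NeZero.one_le (n := L); omega
    omega
  have h1 : insTrace L β O m =
      ∫ V : Fin (n + 1) → GaugeConfig 3 L SU2, ∏ t : Fin (n + 1), κ t (V t) (V (t + 1)) ∂(Measure.pi fun _ => configMeasure SU2 L) := by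
    unfold insTrace
    refine integral_congr_ae (ae_of_all _ fun V => ?_)
    exact insTrace_integrand_eq β O hm hmL V
  have h2 := integral_cyclic_congr_fin (L := L) hn1 κ (configMeasure SU2 L)
  have h3 := integral_cyclic_het_eq_foldr (ρ := configMeasure SU2 L) hκ hC (n - 1)
  rw [h1, h2, h3]
  refine integral_congr_ae (ae_of_all _ fun x => ?_)
  dsimp only
  -- Step 2: split the nested operators: `m - 1` bonds `K`, the bond `K · O`, then `n - m` bonds `K`
  have hsplit : n - 1 + 1 = (m - 1) + (1 + (n - m)) := by omega
  have hseed : (fun w => κ (n - 1 + 1) w x) = fun w => physKernel β w x * O x := by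
    funext w; simp [hκdef, show n - 1 + 1 = n by omega]
  rw [hseed]
  have hG := foldr_add_eq_foldr_foldr (fun (i : ℕ) (f : GaugeConfig 3 L SU2 → ℝ) => fun w => ∫ y, κ i w y * f y ∂configMeasure SU2 L)
    (m - 1) (1 + (n - m)) (fun w => physKernel β w x * O x)
  rw [show (m - 1) + (1 + (n - m)) = n - 1 + 1 by omega] at hG
  rw [hG]
  have hG2 := foldr_add_eq_foldr_foldr (fun (i : ℕ) (f : GaugeConfig 3 L SU2 → ℝ) => fun w => ∫ y, κ (i + (m - 1)) w y * f y ∂configMeasure SU2 L)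
    1 (n - m) (fun w => physKernel β w x * O x)
  rw [hG2, Fin.foldr_succ, Fin.foldr_zero]
  simp only [Fin.val_zero, Nat.zero_add]
  -- the last block: `n - m` bonds `K`
  have hlastblock := foldr_op_eq_iterate_of_eq (ρ := configMeasure SU2 L) κ K (n - m) (1 + (m - 1))
    (fun i hi => by
      have hi1 : i + (1 + (m - 1)) ≠ n := by omega
      have hi2 : i + (1 + (m - 1)) + 1 ≠ m := by omega
      simp [hκdef, hi1, hi2]) (fun w => physKernel β w x * O x)
  have hidx : (fun (i : Fin (n - m)) (f : GaugeConfig 3 L SU2 → ℝ) => fun w => ∫ y, κ ((i : ℕ) + 1 + (m - 1)) w y * f y ∂configMeasure SU2 L) =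
      fun (i : Fin (n - m)) (f : GaugeConfig 3 L SU2 → ℝ) => fun w => ∫ y, κ ((i : ℕ) + (1 + (m - 1))) w y * f y ∂configMeasure SU2 L := by
    funext i f w; simp only [Nat.add_assoc]
  rw [hidx, hlastblock, iterate_kernelOp_mul_const]
  -- the middle bond: `κ_{m-1} = K · O`
  have hmid : κ (m - 1) = fun x y => K x y * O y := by
    have h1 : m - 1 ≠ n := by omega
    have h2 : m - 1 + 1 = m := by omega
    simp [hκdef, h1, h2]
  rw [hmid]
  dsimp only
  -- the first block: `m - 1` bonds `K`
  have hfirst := foldr_op_eq_iterate_of_eq (ρ := configMeasure SU2 L) κ K (m - 1) 0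
    (fun i hi => by
      have hi1 : i ≠ n := by omega
      have hi2 : i + 1 ≠ m := by omega
      simp [hκdef, hi1, hi2])
  have hidx0 : (fun (i : Fin (m - 1)) (f : GaugeConfig 3 L SU2 → ℝ) => fun w => ∫ y, κ (i : ℕ) w y * f y ∂configMeasure SU2 L) =
      fun (i : Fin (m - 1)) (f : GaugeConfig 3 L SU2 → ℝ) => fun w => ∫ y, κ ((i : ℕ) + 0) w y * f y ∂configMeasure SU2 L := by
    funext i f w; simp only [Nat.add_zero]
  rw [hidx0, hfirst]
  -- pull the scalar `O x` out of the whole chain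
  have hin : (fun w => ∫ y, K w y * O y * (((fun f : GaugeConfig 3 L SU2 → ℝ => fun w => ∫ z, K w z * f z ∂configMeasure SU2 L)^[n - m]
        (fun w => physKernel β w x)) y * O x) ∂configMeasure SU2 L) =
      fun w => ((fun f : GaugeConfig 3 L SU2 → ℝ => fun w => ∫ z, K w z * f z ∂configMeasure SU2 L)
        (fun y => O y * ((fun f : GaugeConfig 3 L SU2 → ℝ => fun w => ∫ z, K w z * f z ∂configMeasure SU2 L)^[n - m]
          (fun w => physKernel β w x)) y)) w * O x := by
    funext w
    dsimp only
    rw [← integral_mul_const]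
    exact integral_congr_ae (ae_of_all _ fun y => by ring)
  rw [hin, iterate_kernelOp_mul_const]
  dsimp only
  have hm1 : (m - 1).succ = m := by omega
  rw [mul_comm, ← Function.iterate_succ_apply, hm1, show n - m = 2 * L - 1 - m by omega]

/-! ## §3 The two-arc form with `K_β^P`-iterates -/

/-- **Two-arc form of the two-insertion trace, `K_β^P`-iterates.**  For a PHYSICAL `O` and `1 ≤ m ≤ 2L - 1`,
`insTrace L β O m = ∫ O(x) · (κ_P^[m] (y ↦ O(y) · (κ_P^[2L-1-m] K_β^P(·, x))(y)))(x) dx` with `κ_P f = ∫ K_β^P(·,z) f(z) dz`: on the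
physical seed `K_β^P(·,x)` and on `O · (physical)` the `K_β`- and `K_β^P`-iterates coincide (`iterate_physKernelOp_eq`) — the
path-space form of `Tr(M_O (PK_βP)^m M_O (PK_βP)^{2L-m})`. [cite: Luscher1983, §2] [cite: MontvayMunster1994, (3.145)] -/
theorem insTrace_eq_twoArc (β : ℝ) {O : GaugeConfig 3 L SU2 → ℝ} (hO : IsPhys O) {m : ℕ} (hm : 1 ≤ m) (hmL : m ≤ 2 * L - 1) :
    insTrace L β O m = ∫ x, O x * ((fun f : GaugeConfig 3 L SU2 → ℝ => fun w => ∫ z, physKernel β w z * f z ∂configMeasure SU2 L)^[m]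
      (fun y => O y * ((fun f : GaugeConfig 3 L SU2 → ℝ => fun w => ∫ z, physKernel β w z * f z ∂configMeasure SU2 L)^[2 * L - 1 - m]
        (fun w => physKernel β w x)) y)) x ∂configMeasure SU2 L := by
  obtain ⟨M, -, hM⟩ := exists_abs_transferKernel_le (L := L) β
  obtain ⟨CO, hOb⟩ := hO.bounded
  rw [insTrace_eq_twoArc_K β hO.measurable hOb hm hmL]
  refine integral_congr_ae (ae_of_all _ fun x => ?_)
  dsimp only
  obtain ⟨h1, h2⟩ := iterate_physKernelOp_eq hM (isPhys_physKernel_left hM x) (2 * L - 1 - m)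
  rw [h1]
  have hh : IsPhys fun y => O y * ((fun f : GaugeConfig 3 L SU2 → ℝ => fun w => ∫ z, transferKernel su2Rep β w z * f z ∂configMeasure SU2 L)^[2 * L - 1 - m]
      (fun w => physKernel β w x)) y :=
    IsPhys.mul_of_invariant h2 hO.measurable hOb hO.gaugeInv hO.zeroFlux
  rw [(iterate_physKernelOp_eq hM hh m).1]

/-! ## §4 Composed kernels and the one-bond-insertion form -/

/-- The composed kernels `(x, y) ↦ (κ_P^[j] K_β^P(·, y))(x)` are jointly measurable and bounded. [folklore] -/
theorem measurable_bdd_iterKernelP (β : ℝ) (j : ℕ) :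
    Measurable (uncurry fun x y : GaugeConfig 3 L SU2 =>
      ((fun f : GaugeConfig 3 L SU2 → ℝ => fun w => ∫ z, physKernel β w z * f z ∂configMeasure SU2 L)^[j] (fun w => physKernel β w y)) x) ∧
    ∃ B : ℝ, ∀ x y : GaugeConfig 3 L SU2,
      ‖((fun f : GaugeConfig 3 L SU2 → ℝ => fun w => ∫ z, physKernel β w z * f z ∂configMeasure SU2 L)^[j] (fun w => physKernel β w y)) x‖ ≤ B := by
  obtain ⟨M, -, hM⟩ := exists_abs_transferKernel_le (L := L) β
  have hKP := stronglyMeasurable_physKernel (L := L) β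
  have hCP : ∀ U V : GaugeConfig 3 L SU2, ‖physKernel β U V‖ ≤ M := fun U V => by
    rw [Real.norm_eq_abs]; exact abs_physKernel_le hM U V
  have hΨ : StronglyMeasurable (uncurry fun y w : GaugeConfig 3 L SU2 => physKernel β w y) := by
    have e : (uncurry fun y w : GaugeConfig 3 L SU2 => physKernel β w y) =
        (uncurry fun U V : GaugeConfig 3 L SU2 => physKernel β U V) ∘ Prod.swap := by
      funext p; rcases p with ⟨a, b⟩
      simp only [Function.uncurry_apply_pair, Function.comp_apply, Prod.swap_prod_mk]
    rw [e]; exact hKP.comp_measurable measurable_swap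
  have h1 := stronglyMeasurable_uncurry_iterate_kernel (μ := configMeasure SU2 L) hKP hΨ j
  have h2 : (uncurry fun x y : GaugeConfig 3 L SU2 =>
      ((fun f : GaugeConfig 3 L SU2 → ℝ => fun w => ∫ z, physKernel β w z * f z ∂configMeasure SU2 L)^[j] (fun w => physKernel β w y)) x) =
      (uncurry fun y : GaugeConfig 3 L SU2 =>
        (fun f : GaugeConfig 3 L SU2 → ℝ => fun w => ∫ z, physKernel β w z * f z ∂configMeasure SU2 L)^[j] (fun w => physKernel β w y)) ∘
        Prod.swap := by
    funext p; rcases p with ⟨a, b⟩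
    simp only [Function.uncurry_apply_pair, Function.comp_apply, Prod.swap_prod_mk]
  refine ⟨?_, ⟨M ^ j * M, fun x y => norm_iterate_kernel_le hCP (fun w => hCP w y) j x⟩⟩
  rw [h2]
  exact h1.measurable.comp measurable_swap

/-- **The composed kernel acts as the iterate**: `∫ (κ_P^[j] K_β^P(·,y))(x) g(y) dy = (κ_P^[j+1] g)(x)` for bounded measurable `g`
(Fubini, `j` times). [cite: ReedSimonI1980, Thm. VI.23] -/
theorem integral_iterKernelP_mul (β : ℝ) {g : GaugeConfig 3 L SU2 → ℝ} (hg : Measurable g) {B : ℝ} (hgb : ∀ y, ‖g y‖ ≤ B) :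
    ∀ (j : ℕ) (x : GaugeConfig 3 L SU2),
      ∫ y, ((fun f : GaugeConfig 3 L SU2 → ℝ => fun w => ∫ z, physKernel β w z * f z ∂configMeasure SU2 L)^[j] (fun w => physKernel β w y)) x * g y
          ∂configMeasure SU2 L =
        ((fun f : GaugeConfig 3 L SU2 → ℝ => fun w => ∫ z, physKernel β w z * f z ∂configMeasure SU2 L)^[j + 1] g) x := by
  obtain ⟨M, -, hM⟩ := exists_abs_transferKernel_le (L := L) β
  have hKPm : Measurable (uncurry (physKernel (L := L) β)) := (stronglyMeasurable_physKernel (L := L) β).measurable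
  have hCP : ∀ U V : GaugeConfig 3 L SU2, ‖physKernel β U V‖ ≤ M := fun U V => by
    rw [Real.norm_eq_abs]; exact abs_physKernel_le hM U V
  intro j
  induction j with
  | zero => intro x; simp
  | succ j ih =>
    intro x
    obtain ⟨hKj, Bj, hBj⟩ := measurable_bdd_iterKernelP (L := L) β j
    have hstep : ∀ y, ((fun f : GaugeConfig 3 L SU2 → ℝ => fun w => ∫ z, physKernel β w z * f z ∂configMeasure SU2 L)^[j + 1]
        (fun w => physKernel β w y)) x =
        ∫ z, physKernel β x z * ((fun f : GaugeConfig 3 L SU2 → ℝ => fun w => ∫ z, physKernel β w z * f z ∂configMeasure SU2 L)^[j]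
          (fun w => physKernel β w y)) z ∂configMeasure SU2 L := fun y => by
      rw [Function.iterate_succ_apply']
    simp_rw [hstep]
    rw [← integral_kernel_mul_integral_kernel_mul (ρ := configMeasure SU2 L) hKPm hKj hCP hBj hg hgb x, Function.iterate_succ_apply']
    exact integral_congr_ae (ae_of_all _ fun z => by dsimp only; rw [ih z])

/-- **One-bond-insertion form of the two-insertion trace.**  For a physical `O` and `1 ≤ m ≤ 2L - 1`,
`insTrace L β O m = ∫∫ X_m(x,y) (κ_P^[2L-1-m] K_β^P(·,x))(y) dy dx` with the composite bond `X_m(x,y) = O(x) K_β^{P,(m)}(x,y) O(y)`,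
`K_β^{P,(m)}(x,y) = (κ_P^[m-1] K_β^P(·,y))(x)` — the left-hand side of Literature `hasSum_integral_iterate_insert_one`
(`Tr(𝕏_m (PK_βP)^{2L-m})`). [cite: ReedSimonI1980, Thm. VI.23] [cite: MontvayMunster1994, (3.145)] -/
theorem insTrace_eq_insertOne (β : ℝ) {O : GaugeConfig 3 L SU2 → ℝ} (hO : IsPhys O) {m : ℕ} (hm : 1 ≤ m) (hmL : m ≤ 2 * L - 1) :
    insTrace L β O m = ∫ x, ∫ y,
      (O x * ((fun f : GaugeConfig 3 L SU2 → ℝ => fun w => ∫ z, physKernel β w z * f z ∂configMeasure SU2 L)^[m - 1]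
        (fun w => physKernel β w y)) x * O y) *
      ((fun f : GaugeConfig 3 L SU2 → ℝ => fun w => ∫ z, physKernel β w z * f z ∂configMeasure SU2 L)^[2 * L - 1 - m]
        (fun z => physKernel β z x)) y ∂configMeasure SU2 L ∂configMeasure SU2 L := by
  obtain ⟨M, -, hM⟩ := exists_abs_transferKernel_le (L := L) β
  obtain ⟨CO, hOb⟩ := hO.bounded
  have hKP := stronglyMeasurable_physKernel (L := L) β
  have hCP : ∀ U V : GaugeConfig 3 L SU2, ‖physKernel β U V‖ ≤ M := fun U V => by
    rw [Real.norm_eq_abs]; exact abs_physKernel_le hM U V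
  rw [insTrace_eq_twoArc β hO hm hmL]
  refine integral_congr_ae (ae_of_all _ fun x => ?_)
  dsimp only
  -- the inner observable `h_x = O · κ_P^[2L-1-m] K_β^P(·,x)` is bounded and measurable
  have hkx : Measurable fun w : GaugeConfig 3 L SU2 => physKernel β w x := (isPhys_physKernel_left hM x).measurable
  obtain ⟨⟨B, hB⟩, hmeas⟩ := exists_bound_and_measurable_kernelIterate (μ := configMeasure SU2 L) hKP hCP hkx ⟨M, fun w => hCP w x⟩
    (2 * L - 1 - m)
  have hhm : Measurable fun y => O y * ((fun f : GaugeConfig 3 L SU2 → ℝ => fun w => ∫ z, physKernel β w z * f z ∂configMeasure SU2 L)^[2 * L - 1 - m]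
      (fun w => physKernel β w x)) y := hO.measurable.mul hmeas.measurable
  have hhb : ∀ y, ‖O y * ((fun f : GaugeConfig 3 L SU2 → ℝ => fun w => ∫ z, physKernel β w z * f z ∂configMeasure SU2 L)^[2 * L - 1 - m]
      (fun w => physKernel β w x)) y‖ ≤ CO * B := fun y => by
    rw [norm_mul, Real.norm_eq_abs]
    exact mul_le_mul (hOb y) (hB y) (norm_nonneg _) ((abs_nonneg _).trans (hOb y))
  have key := integral_iterKernelP_mul (L := L) β hhm hhb (m - 1) x
  rw [show m - 1 + 1 = m by omega] at key
  rw [← key, ← integral_const_mul]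
  exact integral_congr_ae (ae_of_all _ fun y => by ring)

end Summit.QuantumFields.YangMills.Theorems.FemtoTransferGap.TT

end
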